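import Summits.AtomisticToContinuum.Crystallization.Theses.ExcessDecayLiouville
import Summits.AtomisticToContinuum.Crystallization.Theses.HcpDefectCounting
import Summits.AtomisticToContinuum.Crystallization.Theorems.ExcessDecayLiouvilleCoarseGrains
import Summits.AtomisticToContinuum.Crystallization.Theorems.CoarseGrains.Negative.PredicateAPI
import Summits.AtomisticToContinuum.Crystallization.Theorems.FineGrains.Negative.LoadBearing
import Summits.AtomisticToContinuum.Crystallization.Theorems.ExcessDecayLiouvilleFineGrainsIsoDictionaryAt
import Summits.AtomisticToContinuum.Crystallization.Theorems.ExcessDecayLiouvilleFineGrainsFlatComparison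
import Summits.AtomisticToContinuum.Crystallization.Theorems.ExcessDecayLiouvilleFineGrainsLineOneGlue
import Summits.AtomisticToContinuum.Crystallization.Theorems.ExcessDecayLiouvilleFineGrainsLineTwoGlue
import Summits.AtomisticToContinuum.Crystallization.Theorems.ExcessDecayLiouvilleFineGrainsSelfCertify
import Summits.AtomisticToContinuum.Crystallization.Theorems.ExcessDecayLiouvilleFineGrainsPigeonholeBall
import Summits.AtomisticToContinuum.Crystallization.Theorems.ExcessDecayLiouvilleFineGrainsLocalFlatness
import Summits.AtomisticToContinuum.Crystallization.Theorems.ExcessDecayLiouvilleFineGrainsPeriodicMin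
import Literature.MathematicalPhysics.StatisticalMechanics.LennardJonesClusters
import Literature.MathematicalPhysics.StatisticalMechanics.BarlowStacking

/-!
# Skeleton line `Sketch` for crux `FineGrains` (stmt-AtomisticToContinuum-9330)

Route `ExcessDecayLiouville`, sub-problem `Crystallization`.  Lead prover
`prover-line-stmt-AtomisticToContinuum-9330-0`, line `Sketch` = ideator 2's `Sketch.lean` (cards
`tube-energy-gap-pigeonhole` and `self-certifying-grains`), REBUILT from the statements quoted verbatim in
the two cards (the evidence copy of the planner's file is not mounted in the lead's jail) and reshaped
within `stubs_max = 7`: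

* LineOne (card tube-energy-gap-pigeonhole): `CoarseGrains → FlatComparison → TubeRigidity → FineGrains`
  — stubs `stub_flatComparison` (hereditary slack of ground-state balls; LANDED p87685),
  `stub_lineOneGlue` (bookkeeping; LANDED p86882) and, after the cycle-2 RESHAPE of `TubeRigidity`
  (`tubeRigidity_of_stubs`, sorry-free): `stub_tubeEnergyGap` (G — THE load-bearing stub, crux-strength,
  held by the lead: the finite-amplitude tube energy gap over realisable fields), `stub_pigeonholeBall`
  (P1; LANDED p89580), `stub_localFlatness` (P2; LANDED p89536); `CoarseGrains` (crux 9331) enters BY NAME.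
* LineTwo (card self-certifying-grains): `BulkDefectVanish → SelfCertify → OptimalPeriodicIsAdmissibleHcp
  → FineGrains` — stubs `stub_selfCertify` (LANDED p86851), `stub_optimalPeriodicIsAdmissibleHcp` (periodic
  uniqueness in the window, ⊇ stmt-3061; open — worker verdict `stub-blocked` on stmt-3061 + uniqueness),
  `stub_lineTwoGlue` (LANDED p86977); `BulkDefectVanish` (shared hinge 0751) enters BY NAME.  By-product
  `stub_fineGrainsGivesPeriodicMin : FineGrains → CrysPeriodicMinAttained` (stmt-0627; LANDED p91073) — on
  this route `closes` carries 0627 as a hypothesis that is downstream of the target.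
* Sibling reduction (TRIAGE-r1-1 §D; card sibling-reduction-at-epsilon): LineOne consumes
  `CoarseGrains` by name and the landed `CoarseGrains_of : HcpBulkFloor → HcpDefectCoercivity →
  CoarseGrains` (truss line, p78256) re-runs verbatim at `(ρ, ε)`, so the SAME two named hypotheses give
  `FineGrains` directly: stub `stub_isoDictionaryAt` (chart dictionary at tolerance ε; LANDED p87382) and
  the composition `FineGrains_of_defectCounting` (sorry-free below, using the landed `windowPin`,
  `trussPropagation`, `exists_clean_ball`, `energyPerParticle_le_of_floor`, `stub_trialBound`).

Status after cycle 2: 8 of 10 registered stubs LANDED; open: `stub_tubeEnergyGap` (G, research) and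
`stub_optimalPeriodicIsAdmissibleHcp` (blocked on stmt-3061 + uniqueness).  The sorry-free conditional
compositions are landed separately as `Theorems/ExcessDecayLiouvilleFineGrains.lean`
(`FineGrains_of_defectCounting`, `FineGrains_of_coarseGrains_of_tubeEnergyGap`,
`FineGrains_of_bulkDefectVanish_of_optimal`).

`Lam`/`Near`/`Adm`/`Inner` are the crux's `let`s verbatim (`Theorems.CoarseGrains.Negative.PredicateAPI`),
`HasFineBall`/`fineGrains_iff` (`Iff.rfl`) come from `Theorems.FineGrains.Negative.LoadBearing`.
Compositions: `FineGrains_of : CoarseGrains → FineGrains` (LineOne), `FineGrains_of_bulkDefectVanish`,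
`FineGrains_of_defectCounting` — each concludes the route decl
`Summit.AtomisticToContinuum.Crystallization.Theses.ExcessDecayLiouville.FineGrains` BY NAME; the only
`sorry`s are the registered `stub_*`.

## Disproof used

`Cruxes/FineGrains/Disproof.lean` (cdisprove cycle 1, no kill) read 2026-08-16: (a) minimality and
largeness load-bearing — LineOne uses minimality once (`FlatComparison`, explicit injective competitor:
particles outside the ball kept, a competitor patch inside the shrunken ball, surplus particles parked far
away) and largeness through `CoarseGrains` at radius `R(ρ,ε)+1`; LineTwo through 0751 and ground-state
existence; (b) vacuity thresholds `ρ < 199/200`, `ε ≥ max(ρ,11/10)` and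
`fineGrains_of_large_radius_small_tol` — stubs are stated for all `ρ, ε > 0` anyway; (c′) `FineGrains →
CoarseGrains` is not logic — not used; no `_false_without_` theorem bites a stub here (`TubeRigidity`
quantifies over injective δ-separated clusters with two-way matching, excluding the 3506 piling witness;
`Inner` on the datum keeps the AA-stacked reference of TRIAGE W3 out).  Negatives index: 3506, 4146 not
approached.
-/

noncomputable section

open Literature.MathematicalPhysics.StatisticalMechanics
open Summit.AtomisticToContinuum.Crystallization.Theorems.CoarseGrains.Negative.PredicateAPI
open Summit.AtomisticToContinuum.Crystallization.Theorems.FineGrains.Negative.LoadBearing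
open Summit.AtomisticToContinuum.Crystallization.Theorems.ExcessDecayLiouvilleCoarseGrains
open Summit.AtomisticToContinuum.Crystallization.Theses

namespace Summit.AtomisticToContinuum.Crystallization.Cruxes.FineGrains.Sketch

/-! ## Statements -/

/-- **FlatComparison** (LineOne support; hereditary slack — provable now, size M).  For every `δ > 0`
there is `C` such that every ball `B_R(c)` (`R ≥ 1`) of a `δ`-separated Lennard-Jones ground state `x`
is a `C R²`-almost-minimiser of its own particle number against ARBITRARY injective competitor patches
`y'` with at most as many particles placed in the shrunken ball `B_{R-1}(c)`: `E(y) ≤ E(y') + C R²`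
where `y` enumerates `range x ∩ B_R(c)`.  Proof idea: `E(x) ≤ E(x_out ∪ y' ∪ parked)` (minimality,
surplus particles parked far away at cost `↗ 0`), `E_cross(y', x_out) ≤ 0` (every exterior particle is
`≥ 1` from `B_{R-1}(c)` and `V_LJ ≤ 0` on `[1, ∞)`), `-E_cross(y, x_out) ≤ C_δ R²` (`V_LJ ≥ -r⁻⁶/6`,
`δ`-separation, shells by depth, `∑ depth⁻³ = O(R²)`). -/
def FlatComparison : Prop :=
  ∀ δ : ℝ, 0 < δ → ∃ C : ℝ, ∀ (N : ℕ) (x : Fin N → E3), IsGroundState lennardJones x →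
    (∀ i j : Fin N, i ≠ j → δ ≤ dist (x i) (x j)) →
    ∀ (c : E3) (R : ℝ), 1 ≤ R → ∀ (n : ℕ) (y : Fin n → E3), Function.Injective y →
      (∀ p : E3, p ∈ Set.range y ↔ p ∈ Set.range x ∧ dist p c ≤ R) →
      ∀ (n' : ℕ) (y' : Fin n' → E3), n' ≤ n → Function.Injective y' →
        (∀ i : Fin n', dist (y' i) c ≤ R - 1) →
        interactionEnergy lennardJones y ≤ interactionEnergy lennardJones y' + C * R ^ 2

/-- **TubeRigidity** (LineOne crux stub; the load-bearing statement of card tube-energy-gap-pigeonhole).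
For all `ρ, ε, δ > 0` there are `η > 0` and `R₁` such that for `R ≥ R₁`, every admissible `Inner` datum
`(c, t, A)` and every injective `δ`-separated cluster `y` in `B_R(c)` lying pointwise in the `1/40`-tube
of the sites, two-way `1/40`-matched on `B_{R-1}(c)`, and `ηR³`-almost-minimal against arbitrary
injective competitors with at most as many particles in `B_{R-1}(c)`, there is an `ε`-fine `ρ`-ball
`B_ρ(c') ⊆ B_{R-1}(c)` (datum `(t', A')`, `Adm A'`, `t'` free).  Internally: tube energy gap
`E(y) - E(flat_{t*,A}) ≥ κ_E Σ_nn |Du|² - C R²` over realisable tube fields (kit j012653/j012832/j013310: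
`κ_E(1/40) ≈ 0.48`, window minimum `≈ 0.32`; NOT certified) ⇒ mean-square flatness
`Σ_{B_{R-1}} |Du|² ≤ (ηR³ + 2CR²)/κ_E` ⇒ pigeonhole over `(R/2ρ)³` disjoint `ρ`-balls ⇒ oscillation
`≤ ε` on one of them ⇒ re-fit `t' = t + ū`, `A' = A`. -/
def TubeRigidity : Prop :=
  ∀ ρ ε δ : ℝ, 0 < ρ → 0 < ε → 0 < δ → ∃ η : ℝ, 0 < η ∧ ∃ R₁ : ℝ, ∀ R : ℝ, R₁ ≤ R →
    ∀ (c : E3) (t : Fin 2 → E3) (A : E3 →L[ℝ] E3), Adm A → Inner t A →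
    ∀ (n : ℕ) (y : Fin n → E3), Function.Injective y →
      (∀ i j : Fin n, i ≠ j → δ ≤ dist (y i) (y j)) →
      (∀ i : Fin n, dist (y i) c ≤ R) →
      (∀ i : Fin n, ∃ m : Fin 2, ∃ z ∈ Lam, dist (y i) (t m + A z) ≤ 1 / 40) →
      Near (Set.range y) c (R - 1) t A (1 / 40) →
      (∀ (n' : ℕ) (y' : Fin n' → E3), n' ≤ n → Function.Injective y' →
        (∀ i : Fin n', dist (y' i) c ≤ R - 1) →
        interactionEnergy lennardJones y ≤ interactionEnergy lennardJones y' + η * R ^ 3) →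
      ∃ (c' : E3) (t' : Fin 2 → E3) (A' : E3 →L[ℝ] E3),
        Adm A' ∧ dist c' c + ρ ≤ R - 1 ∧ Near (Set.range y) c' ρ t' A' ε

/-- **LineOneGlue** (bookkeeping, size M): `CoarseGrains` BY NAME, `FlatComparison` and `TubeRigidity`
give the crux matrix.  Given `(ρ, ε)`: `δ = 1/3` (`LennardJonesMinimalDistance_holds`); `(η, R₁)` from
`TubeRigidity`; `C` from `FlatComparison`; `R := max (max R₁ 1) (|C|/η)` so that `C R² ≤ η R³`; `N₀`
from `CoarseGrains` at radius `R + 1`; `y :=` an enumeration of the finite set `range x ∩ B_R(c)`;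
`Near` at `R + 1` for `x` gives the pointwise tube and `Near` at `R - 1` for `y` (a matching particle of a
site within `R - 1` of `c` is within `R - 1 + 1/40 ≤ R` of `c`); the fine ball of `y` is a fine ball of
`x` because `dist c' c + ρ ≤ R - 1`. -/
def LineOneGlue : Prop :=
  ExcessDecayLiouville.CoarseGrains → FlatComparison → TubeRigidity →
    ∀ ρ ε : ℝ, 0 < ρ → 0 < ε → ∃ N₀ : ℕ, ∀ N : ℕ, N₀ ≤ N → ∀ x : Fin N → E3,
      IsGroundState lennardJones x → HasFineBall ρ ε x

/-- **SelfCertify** (LineTwo support; provable, size M/L).  A periodic configuration `P` that appears,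
for every `(R, ε)` and frequently in `N`, as an origin-based isometric two-way `ε`-fine `R`-chart at a
particle of a Lennard-Jones ground state, is a MINIMISER of the energy per particle:
`n·e(P) - C_P R² ≤ E(P-ball) ≤ E(grain) + C n ε + C R² ≤ E(n) + C R² + C n ε ≤ n (e* + o(1)) + …`
(excision surgery of the grain + `crysEnergyLimit_proof`, 0626 PROVED; `e* = ⨅_Q e(Q) ≤ e(Q)` by
`crysPeriodicBddBelow_proof`, 0714 PROVED). -/
def SelfCertify : Prop :=
  ∀ P : PeriodicConfiguration 3,
    (∀ R ε : ℝ, 0 < R → 0 < ε → ∀ N₀ : ℕ, ∃ N : ℕ, N₀ ≤ N ∧ ∃ x : Fin N → E3,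
      IsGroundState lennardJones x ∧ ∃ (i : Fin N) (A : E3 →ₗᵢ[ℝ] E3),
        (∀ p ∈ P.points, ‖p‖ ≤ R → ∃ j : Fin N, dist (x j) (x i + A p) ≤ ε) ∧
        (∀ j : Fin N, dist (x j) (x i) ≤ R → ∃ p ∈ P.points, dist (x j) (x i + A p) ≤ ε)) →
    IsLeast (Set.range fun Q : PeriodicConfiguration 3 => Q.energyPerParticle lennardJones)
      (P.energyPerParticle lennardJones)

/-- **OptimalPeriodicIsAdmissibleHcp** (LineTwo crux stub; CONTAINS `HcpPeriodicMinimiser` stmt-3061 and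
adds uniqueness up to isometry plus the window arithmetic — open): every periodic minimiser of the
Lennard-Jones energy per particle in `ℝ³` is, as a point set, an admissible affine hcp two-lattice
`{t m + A z : m ∈ {0,1}, z ∈ Λ}` with `Adm A`. -/
def OptimalPeriodicIsAdmissibleHcp : Prop :=
  ∀ Q : PeriodicConfiguration 3,
    IsLeast (Set.range fun Q' : PeriodicConfiguration 3 => Q'.energyPerParticle lennardJones)
      (Q.energyPerParticle lennardJones) →
    ∃ (t : Fin 2 → E3) (A : E3 →L[ℝ] E3), Adm A ∧ Q.points = {p | ∃ m : Fin 2, ∃ z ∈ Lam, p = t m + A z}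

/-- **LineTwoGlue** (bookkeeping, size M): `BulkDefectVanish` (0751) BY NAME, `SelfCertify` and
`OptimalPeriodicIsAdmissibleHcp` give the crux matrix.  The hinge's `P` is certified a minimiser by
`SelfCertify` (good particles exist eventually along the sequence of ground states supplied by
`LennardJonesGroundStatesExist_holds`, since `#Bad/N → 0`), hence `P.points = {t m + A₀ z}` with `Adm A₀`;
a Good(ρ, ε) particle `i` (isometry `A`) is a fine ball: centre `x i`, `t' m = x i + A (t m)`,
`A' = A ∘ A₀` (`Adm` is isometry-invariant); and for `N` large EVERY ground state has a Good particle
(splice the bad ground states into one sequence and apply 0751: `#Bad/N → 0` forbids `#Bad = N`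
infinitely often). -/
def LineTwoGlue : Prop :=
  HcpDefectCounting.BulkDefectVanish → SelfCertify → OptimalPeriodicIsAdmissibleHcp →
    ∀ ρ ε : ℝ, 0 < ρ → 0 < ε → ∃ N₀ : ℕ, ∀ N : ℕ, N₀ ≤ N → ∀ x : Fin N → E3,
      IsGroundState lennardJones x → HasFineBall ρ ε x

/-- **IsoDictionaryAt** (sibling reduction; size S — the landed `stub_isoDictionary` of the truss line with
the tolerance `1/40` replaced by a parameter `ε`, centre made explicit): for `(a, h)` in the admissible
window, an origin-based isometric two-way `ε`-chart of radius `R` at particle `x i` onto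
`x i + A (hcp(a,h))` IS a crux datum at tolerance `ε`: centre `x i`, origins `x i`,
`x i + A (barlowOffset a + layerNormal h)`, cell `A ∘ diag(a, a, h/√(2/3))` (`Adm` with the isometry `A`,
`Inner` with norm `0`), the two matching clauses translating literally. -/
def IsoDictionaryAt : Prop :=
  ∀ (a h : ℝ) (ha : a ≠ 0) (hh : h ≠ 0),
    |a - 97 / 100| ≤ 1 / 40 → |h / Real.sqrt (2 / 3) - 97 / 100| ≤ 1 / 40 →
  ∀ (ε : ℝ) (N : ℕ) (x : Fin N → E3) (i : Fin N) (R : ℝ),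
    (∃ A : E3 →ₗᵢ[ℝ] E3,
      (∀ p ∈ (hcpPeriodicConfiguration ha hh).points, ‖p‖ ≤ R →
        ∃ j : Fin N, dist (x j) (x i + A p) ≤ ε) ∧
      (∀ j : Fin N, dist (x j) (x i) ≤ R →
        ∃ p ∈ (hcpPeriodicConfiguration ha hh).points, dist (x j) (x i + A p) ≤ ε)) →
    ∃ (t : Fin 2 → E3) (A' : E3 →L[ℝ] E3), Adm A' ∧ Inner t A' ∧ Near (Set.range x) (x i) R t A' ε

/-! ## Registered stubs (the only `sorry`s of this file) -/

/-- **stub_flatComparison** — registered stub, statement `FlatComparison` verbatim (M, provable now). -/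
theorem stub_flatComparison :
    ∀ δ : ℝ, 0 < δ → ∃ C : ℝ, ∀ (N : ℕ) (x : Fin N → E3), IsGroundState lennardJones x →
    (∀ i j : Fin N, i ≠ j → δ ≤ dist (x i) (x j)) →
    ∀ (c : E3) (R : ℝ), 1 ≤ R → ∀ (n : ℕ) (y : Fin n → E3), Function.Injective y →
      (∀ p : E3, p ∈ Set.range y ↔ p ∈ Set.range x ∧ dist p c ≤ R) →
      ∀ (n' : ℕ) (y' : Fin n' → E3), n' ≤ n → Function.Injective y' →
        (∀ i : Fin n', dist (y' i) c ≤ R - 1) →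
        interactionEnergy lennardJones y ≤ interactionEnergy lennardJones y' + C * R ^ 2 :=
  Theorems.ExcessDecayLiouvilleFineGrains.stub_flatComparison

/-! ### `TubeRigidity` reshaped (cycle 2): tube energy gap (G) + pigeonhole (P1) + local flatness (P2)

The displacement of particle `i` from its RELAXED site is `v i := y i - (t (m i) + d (m i) + A (z i))`
(`t (m i) + A (z i)` its unique site within `1/40`, `d : Fin 2 → E3` a per-sublattice shift chosen by
the gap — the relaxed inner displacement of the cell `A`, TRIAGE-r1-1 W3 / card "HcpNotBravais" bullet);
the quadratic form is `Q(c₀, r) := Σ_{i j : y i, y j ∈ B_r(c₀), dist (y i) (y j) ≤ 4} ‖v i - v j‖²`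
(pairs up to distance `4`, so that chaining along a segment through the `11/10`-covering site set needs
no graph theory; at fixed range `4` this is equivalent to the nearest-neighbour form up to a constant). -/

/-- **stub_tubeEnergyGap** (G) — registered stub (THE LOAD-BEARING STUB of LineOne after the reshape;
crux-strength, held by the lead): for every separation `δ > 0` there are `κ > 0`, `C`, `R₂` such that
every injective `δ`-separated cluster `y` in `B_R(c)` (`R ≥ R₂`) lying in the `1/40`-tube of an
admissible `Inner` datum and two-way `1/40`-matched on `B_{R-1}(c)` admits per-sublattice shifts `d`
(‖d k‖ ≤ 1), a site assignment `(m, z)` and a COMPETITOR `y'` (at most as many particles, injective, in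
`B_{R-1}(c)`; intended: the relaxed flat patch) with `E(y') + κ·Q(c, R-2) ≤ E(y) + C R²` — the
finite-amplitude TUBE ENERGY GAP over realisable fields (kit j012653/j012832/j013310: `κ_E(1/40) ≈ 0.48`
at the relaxed cell, window minimum `≈ 0.32`; rigid rotations / uniform strains inside the tube have
`Q = O(R)`, absorbed by `C R²`; NOT certified). -/
theorem stub_tubeEnergyGap :
    ∀ δ : ℝ, 0 < δ → ∃ κ : ℝ, 0 < κ ∧ ∃ C R₂ : ℝ, ∀ R : ℝ, R₂ ≤ R →
    ∀ (c : E3) (t : Fin 2 → E3) (A : E3 →L[ℝ] E3), Adm A → Inner t A →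
    ∀ (n : ℕ) (y : Fin n → E3), Function.Injective y →
      (∀ i j : Fin n, i ≠ j → δ ≤ dist (y i) (y j)) →
      (∀ i : Fin n, dist (y i) c ≤ R) →
      (∀ i : Fin n, ∃ m : Fin 2, ∃ z ∈ Lam, dist (y i) (t m + A z) ≤ 1 / 40) →
      Near (Set.range y) c (R - 1) t A (1 / 40) →
      ∃ (d : Fin 2 → E3) (m : Fin n → Fin 2) (z : Fin n → E3),
        (∀ k : Fin 2, ‖d k‖ ≤ 1) ∧
        (∀ i : Fin n, z i ∈ Lam ∧ dist (y i) (t (m i) + A (z i)) ≤ 1 / 40) ∧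
        ∃ (n' : ℕ) (y' : Fin n' → E3), n' ≤ n ∧ Function.Injective y' ∧
          (∀ i : Fin n', dist (y' i) c ≤ R - 1) ∧
          interactionEnergy lennardJones y' +
            κ * (∑ i : Fin n, ∑ j : Fin n,
              if dist (y i) c ≤ R - 2 ∧ dist (y j) c ≤ R - 2 ∧ dist (y i) (y j) ≤ 4 then
                ‖(y i - (t (m i) + d (m i) + A (z i))) - (y j - (t (m j) + d (m j) + A (z j)))‖ ^ 2
              else 0) ≤
          interactionEnergy lennardJones y + C * R ^ 2 := by
  sorry

/-- **stub_pigeonholeBall** (P1) — registered stub (elementary, size M): for a non-negative pair weight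
`w` on finitely many points, some ball `B_{ρ+5}(c')` well inside `B_{R-1}(c)`
(`dist c' c + ρ + 8 ≤ R - 1`) carries at most a `(M₀ R³)⁻¹` fraction of the total weight of the pairs
inside `B_{R-2}(c)` — a cubic grid of `≥ M₀ R³` centres `2ρ + 10` apart makes the balls disjoint, and
the minimum is at most the average. -/
theorem stub_pigeonholeBall :
    ∀ ρ : ℝ, 0 < ρ → ∃ M₀ : ℝ, 0 < M₀ ∧ ∃ R₀ : ℝ, ∀ R : ℝ, R₀ ≤ R →
    ∀ (c : E3) (n : ℕ) (y : Fin n → E3) (w : Fin n → Fin n → ℝ), (∀ i j : Fin n, 0 ≤ w i j) →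
      ∃ c' : E3, dist c' c + ρ + 8 ≤ R - 1 ∧
        M₀ * R ^ 3 * (∑ i : Fin n, ∑ j : Fin n,
            if dist (y i) c' ≤ ρ + 5 ∧ dist (y j) c' ≤ ρ + 5 then w i j else 0) ≤
          ∑ i : Fin n, ∑ j : Fin n,
            if dist (y i) c ≤ R - 2 ∧ dist (y j) c ≤ R - 2 then w i j else 0 :=
  Theorems.ExcessDecayLiouvilleFineGrains.stub_pigeonholeBall

/-- **stub_localFlatness** (P2) — registered stub (size M/L): if the local quadratic form on
`B_{ρ+5}(c')` is at most `θ(ρ, ε)`, the cluster is `ε`-fine on `B_ρ(c')` with the re-fitted datum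
`t' k = t k + d k + v i₀`, `A' = A`.  Chain any two particles of `B_{ρ+3}(c')` along the segment
through sites (covering radius `11/10`, `exists_site_near`; each chain site within `ρ + 8` of `c'` owns
a particle by the two-way matching, unique by `site_eq_of_dist_lt` / `le_dist_site_cross`), consecutive
chain particles are `≤ 4` apart, so the oscillation of `v` is `≤ (2ρ + 8)·√θ ≤ ε`; clause (ii) of
`Near` for the new sites uses the old matching at `1/40` and the same uniqueness. -/
theorem stub_localFlatness :
    ∀ ρ ε : ℝ, 0 < ρ → 0 < ε → ∃ θ : ℝ, 0 < θ ∧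
    ∀ (c' : E3) (t : Fin 2 → E3) (A : E3 →L[ℝ] E3), Adm A → Inner t A →
    ∀ (n : ℕ) (y : Fin n → E3) (d : Fin 2 → E3) (m : Fin n → Fin 2) (z : Fin n → E3),
      (∀ k : Fin 2, ‖d k‖ ≤ 1) →
      (∀ i : Fin n, z i ∈ Lam ∧ dist (y i) (t (m i) + A (z i)) ≤ 1 / 40) →
      Near (Set.range y) c' (ρ + 8) t A (1 / 40) →
      (∑ i : Fin n, ∑ j : Fin n,
          if dist (y i) c' ≤ ρ + 5 ∧ dist (y j) c' ≤ ρ + 5 ∧ dist (y i) (y j) ≤ 4 then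
            ‖(y i - (t (m i) + d (m i) + A (z i))) - (y j - (t (m j) + d (m j) + A (z j)))‖ ^ 2
          else 0) ≤ θ →
      ∃ (t' : Fin 2 → E3) (A' : E3 →L[ℝ] E3), Adm A' ∧ Near (Set.range y) c' ρ t' A' ε :=
  Theorems.ExcessDecayLiouvilleFineGrains.stub_localFlatness

/-- **stub_fineGrainsGivesPeriodicMin** (B) — registered stub (by-product of LineTwo for the tenure
planner, size M; card self-certifying-grains): `FineGrains → CrysPeriodicMinAttained` (stmt-0627) — fine
grains at every `(ρ, ε)` give, by compactness of normalised admissible data (`near_normalise`,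
`adm_lower/upper`, `exists_periodicConfiguration_two` of `ExcessDecayLiouvilleLimitGlue`), ONE affine
two-lattice `P∞` appearing as fine grains at every scale, frequently in `N`; the landed
`energyPerParticle_le_eStar_of_charts` / `stub_selfCertify` make it a least element.  On this route
`closes` then carries stmt-0627 as a hypothesis that is downstream of the target. -/
theorem stub_fineGrainsGivesPeriodicMin :
    ExcessDecayLiouville.FineGrains → ExcessDecayLiouville.CrysPeriodicMinAttained :=
  Theorems.ExcessDecayLiouvilleFineGrains.stub_fineGrainsGivesPeriodicMin

/-- `Near` restricts to a smaller ball inside: `B_{r'}(c') ⊆ B_r(c)`. [folklore] -/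
theorem near_of_subset {X : Set E3} {c c' : E3} {r r' ε : ℝ} {t : Fin 2 → E3} {A : E3 →L[ℝ] E3}
    (h : dist c' c + r' ≤ r) (hN : Near X c r t A ε) : Near X c' r' t A ε := by
  refine ⟨fun p hp hpc => hN.1 p hp ?_, fun m z hz hzc => hN.2 m z hz ?_⟩
  · linarith [dist_triangle p c' c]
  · linarith [dist_triangle (t m + A z) c' c]

/-- **`TubeRigidity` from (G) + (P1) + (P2)** (sorry-free composition, cycle-2 reshape): the gap's
competitor and the almost-minimality give `κ·Q(c, R-2) ≤ ηR³ + CR²`; pigeonhole gives a ball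
`B_{ρ+5}(c')` with `Q(c', ρ+5) ≤ (ηR³ + CR²)/(κ M₀ R³) ≤ θ` once `η ≤ κθM₀/2` and `R ≥ 2C/(κθM₀)`;
local flatness gives the fine ball. -/
theorem tubeRigidity_of_stubs :
    ∀ ρ ε δ : ℝ, 0 < ρ → 0 < ε → 0 < δ → ∃ η : ℝ, 0 < η ∧ ∃ R₁ : ℝ, ∀ R : ℝ, R₁ ≤ R →
    ∀ (c : E3) (t : Fin 2 → E3) (A : E3 →L[ℝ] E3), Adm A → Inner t A →
    ∀ (n : ℕ) (y : Fin n → E3), Function.Injective y →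
      (∀ i j : Fin n, i ≠ j → δ ≤ dist (y i) (y j)) →
      (∀ i : Fin n, dist (y i) c ≤ R) →
      (∀ i : Fin n, ∃ m : Fin 2, ∃ z ∈ Lam, dist (y i) (t m + A z) ≤ 1 / 40) →
      Near (Set.range y) c (R - 1) t A (1 / 40) →
      (∀ (n' : ℕ) (y' : Fin n' → E3), n' ≤ n → Function.Injective y' →
        (∀ i : Fin n', dist (y' i) c ≤ R - 1) →
        interactionEnergy lennardJones y ≤ interactionEnergy lennardJones y' + η * R ^ 3) →
      ∃ (c' : E3) (t' : Fin 2 → E3) (A' : E3 →L[ℝ] E3),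
        Adm A' ∧ dist c' c + ρ ≤ R - 1 ∧ Near (Set.range y) c' ρ t' A' ε := by
  intro ρ ε δ hρ hε hδ
  obtain ⟨κ, hκ, C, R₂, hG⟩ := stub_tubeEnergyGap δ hδ
  obtain ⟨M₀, hM₀, R₀, hP⟩ := stub_pigeonholeBall ρ hρ
  obtain ⟨θ, hθ, hL⟩ := stub_localFlatness ρ ε hρ hε
  refine ⟨κ * θ * M₀ / 2, by positivity, max (max R₂ R₀) (max 1 (2 * |C| / (κ * θ * M₀))), ?_⟩
  intro R hR c t A hA hI n y hy hsep hball htube hNear hmin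
  have hR₂ : R₂ ≤ R := le_trans (le_max_left _ _) (le_trans (le_max_left _ _) hR)
  have hR₀ : R₀ ≤ R := le_trans (le_max_right _ _) (le_trans (le_max_left _ _) hR)
  have hR1 : 1 ≤ R := le_trans (le_max_left _ _) (le_trans (le_max_right _ _) hR)
  have hRC : 2 * |C| / (κ * θ * M₀) ≤ R := le_trans (le_max_right _ _) (le_trans (le_max_right _ _) hR)
  have hRpos : 0 < R := lt_of_lt_of_le one_pos hR1
  -- (G): the competitor and the quadratic form
  obtain ⟨d, m, z, hd, hsite, n', y', hn', hy', hball', hgap⟩ :=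
    hG R hR₂ c t A hA hI n y hy hsep hball htube hNear
  -- almost-minimality against that competitor
  have hcomp := hmin n' y' hn' hy' hball'
  set Q : ℝ := ∑ i : Fin n, ∑ j : Fin n,
      if dist (y i) c ≤ R - 2 ∧ dist (y j) c ≤ R - 2 ∧ dist (y i) (y j) ≤ 4 then
        ‖(y i - (t (m i) + d (m i) + A (z i))) - (y j - (t (m j) + d (m j) + A (z j)))‖ ^ 2
      else 0 with hQ
  have hκQ : κ * Q ≤ κ * θ * M₀ / 2 * R ^ 3 + C * R ^ 2 := by linarith
  -- (P1): pigeonhole with the weight `w i j = [dist ≤ 4] ‖v i - v j‖²`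
  set w : Fin n → Fin n → ℝ := fun i j =>
      if dist (y i) (y j) ≤ 4 then
        ‖(y i - (t (m i) + d (m i) + A (z i))) - (y j - (t (m j) + d (m j) + A (z j)))‖ ^ 2
      else 0 with hw
  have hw0 : ∀ i j, 0 ≤ w i j := fun i j => by
    simp only [hw]; split_ifs <;> positivity
  obtain ⟨c', hc', hpig⟩ := hP R hR₀ c n y w hw0
  have hQw : (∑ i : Fin n, ∑ j : Fin n,
      if dist (y i) c ≤ R - 2 ∧ dist (y j) c ≤ R - 2 then w i j else 0) = Q := by
    simp only [hQ, hw]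
    refine Finset.sum_congr rfl fun i _ => Finset.sum_congr rfl fun j _ => ?_
    by_cases h1 : dist (y i) c ≤ R - 2 ∧ dist (y j) c ≤ R - 2
    · by_cases h2 : dist (y i) (y j) ≤ 4
      · rw [if_pos h1, if_pos h2, if_pos ⟨h1.1, h1.2, h2⟩]
      · rw [if_pos h1, if_neg h2, if_neg (fun h => h2 h.2.2)]
    · rw [if_neg h1, if_neg (fun h => h1 ⟨h.1, h.2.1⟩)]
  rw [hQw] at hpig
  set Qloc : ℝ := ∑ i : Fin n, ∑ j : Fin n,
      if dist (y i) c' ≤ ρ + 5 ∧ dist (y j) c' ≤ ρ + 5 then w i j else 0 with hQloc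
  have hQloc_eq : (∑ i : Fin n, ∑ j : Fin n,
      if dist (y i) c' ≤ ρ + 5 ∧ dist (y j) c' ≤ ρ + 5 ∧ dist (y i) (y j) ≤ 4 then
        ‖(y i - (t (m i) + d (m i) + A (z i))) - (y j - (t (m j) + d (m j) + A (z j)))‖ ^ 2
      else 0) = Qloc := by
    simp only [hQloc, hw]
    refine Finset.sum_congr rfl fun i _ => Finset.sum_congr rfl fun j _ => ?_
    by_cases h1 : dist (y i) c' ≤ ρ + 5 ∧ dist (y j) c' ≤ ρ + 5
    · by_cases h2 : dist (y i) (y j) ≤ 4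
      · rw [if_pos h1, if_pos h2, if_pos ⟨h1.1, h1.2, h2⟩]
      · rw [if_pos h1, if_neg h2, if_neg (fun h => h2 h.2.2)]
    · rw [if_neg h1, if_neg (fun h => h1 ⟨h.1, h.2.1⟩)]
  -- the local form is at most θ
  have hQloc0 : 0 ≤ Qloc := by
    simp only [hQloc]
    refine Finset.sum_nonneg fun i _ => Finset.sum_nonneg fun j _ => ?_
    split_ifs
    · exact hw0 i j
    · exact le_rfl
  have hkθM : 0 < κ * θ * M₀ := by positivity
  have hCR : |C| * R ^ 2 ≤ κ * θ * M₀ / 2 * R ^ 3 := by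
    have h1 : 2 * |C| ≤ κ * θ * M₀ * R := by
      have := (div_le_iff₀ hkθM).1 hRC
      linarith
    nlinarith [sq_nonneg R, hRpos]
  have hC_le : C * R ^ 2 ≤ |C| * R ^ 2 :=
    mul_le_mul_of_nonneg_right (le_abs_self C) (by positivity)
  have hθ' : Qloc ≤ θ := by
    -- M₀ R³ Qloc ≤ Q ≤ (κθM₀/2 R³ + C R²)/κ ≤ θ M₀ R³
    have h1 : M₀ * R ^ 3 * Qloc ≤ Q := hpig
    have h2 : κ * (M₀ * R ^ 3 * Qloc) ≤ κ * θ * M₀ / 2 * R ^ 3 + C * R ^ 2 :=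
      le_trans (mul_le_mul_of_nonneg_left h1 hκ.le) hκQ
    have h3 : κ * (M₀ * R ^ 3 * Qloc) ≤ κ * θ * M₀ * R ^ 3 := by linarith
    have h4 : κ * M₀ * R ^ 3 * Qloc ≤ κ * M₀ * R ^ 3 * θ := by nlinarith
    have h5 : 0 < κ * M₀ * R ^ 3 := by positivity
    exact le_of_mul_le_mul_left h4 h5
  -- (P2): local flatness on B_ρ(c')
  have hNear' : Near (Set.range y) c' (ρ + 8) t A (1 / 40) :=
    near_of_subset (by linarith) hNear
  rw [← hQloc_eq] at hθ'
  obtain ⟨t', A', hA', hN'⟩ := hL c' t A hA hI n y d m z hd hsite hNear' hθ'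
  exact ⟨c', t', A', hA', by linarith, hN'⟩

/-- **stub_lineOneGlue** — registered stub, statement `LineOneGlue` with its two stub hypotheses
`FlatComparison`, `TubeRigidity` UNFOLDED (so that the landed theorem needs no tree-side named `Prop`;
`CoarseGrains` is the route decl BY NAME) (M, bookkeeping). -/
theorem stub_lineOneGlue :
    ExcessDecayLiouville.CoarseGrains →
    (∀ δ : ℝ, 0 < δ → ∃ C : ℝ, ∀ (N : ℕ) (x : Fin N → E3), IsGroundState lennardJones x →
      (∀ i j : Fin N, i ≠ j → δ ≤ dist (x i) (x j)) →
      ∀ (c : E3) (R : ℝ), 1 ≤ R → ∀ (n : ℕ) (y : Fin n → E3), Function.Injective y →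
        (∀ p : E3, p ∈ Set.range y ↔ p ∈ Set.range x ∧ dist p c ≤ R) →
        ∀ (n' : ℕ) (y' : Fin n' → E3), n' ≤ n → Function.Injective y' →
          (∀ i : Fin n', dist (y' i) c ≤ R - 1) →
          interactionEnergy lennardJones y ≤ interactionEnergy lennardJones y' + C * R ^ 2) →
    (∀ ρ ε δ : ℝ, 0 < ρ → 0 < ε → 0 < δ → ∃ η : ℝ, 0 < η ∧ ∃ R₁ : ℝ, ∀ R : ℝ, R₁ ≤ R →
      ∀ (c : E3) (t : Fin 2 → E3) (A : E3 →L[ℝ] E3), Adm A → Inner t A →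
      ∀ (n : ℕ) (y : Fin n → E3), Function.Injective y →
        (∀ i j : Fin n, i ≠ j → δ ≤ dist (y i) (y j)) →
        (∀ i : Fin n, dist (y i) c ≤ R) →
        (∀ i : Fin n, ∃ m : Fin 2, ∃ z ∈ Lam, dist (y i) (t m + A z) ≤ 1 / 40) →
        Near (Set.range y) c (R - 1) t A (1 / 40) →
        (∀ (n' : ℕ) (y' : Fin n' → E3), n' ≤ n → Function.Injective y' →
          (∀ i : Fin n', dist (y' i) c ≤ R - 1) →
          interactionEnergy lennardJones y ≤ interactionEnergy lennardJones y' + η * R ^ 3) →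
        ∃ (c' : E3) (t' : Fin 2 → E3) (A' : E3 →L[ℝ] E3),
          Adm A' ∧ dist c' c + ρ ≤ R - 1 ∧ Near (Set.range y) c' ρ t' A' ε) →
    ∀ ρ ε : ℝ, 0 < ρ → 0 < ε → ∃ N₀ : ℕ, ∀ N : ℕ, N₀ ≤ N → ∀ x : Fin N → E3,
      IsGroundState lennardJones x → HasFineBall ρ ε x :=
  Theorems.ExcessDecayLiouvilleFineGrains.stub_lineOneGlue

/-- **stub_selfCertify** — registered stub, statement `SelfCertify` verbatim (M/L, provable). -/
theorem stub_selfCertify :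
    ∀ P : PeriodicConfiguration 3,
    (∀ R ε : ℝ, 0 < R → 0 < ε → ∀ N₀ : ℕ, ∃ N : ℕ, N₀ ≤ N ∧ ∃ x : Fin N → E3,
      IsGroundState lennardJones x ∧ ∃ (i : Fin N) (A : E3 →ₗᵢ[ℝ] E3),
        (∀ p ∈ P.points, ‖p‖ ≤ R → ∃ j : Fin N, dist (x j) (x i + A p) ≤ ε) ∧
        (∀ j : Fin N, dist (x j) (x i) ≤ R → ∃ p ∈ P.points, dist (x j) (x i + A p) ≤ ε)) →
    IsLeast (Set.range fun Q : PeriodicConfiguration 3 => Q.energyPerParticle lennardJones)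
      (P.energyPerParticle lennardJones) :=
  Theorems.ExcessDecayLiouvilleFineGrains.stub_selfCertify

/-- **stub_optimalPeriodicIsAdmissibleHcp** — registered stub, statement `OptimalPeriodicIsAdmissibleHcp`
verbatim (open: ⊇ HcpPeriodicMinimiser stmt-3061 + uniqueness up to isometry). -/
theorem stub_optimalPeriodicIsAdmissibleHcp :
    ∀ Q : PeriodicConfiguration 3,
    IsLeast (Set.range fun Q' : PeriodicConfiguration 3 => Q'.energyPerParticle lennardJones)
      (Q.energyPerParticle lennardJones) →
    ∃ (t : Fin 2 → E3) (A : E3 →L[ℝ] E3), Adm A ∧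
      Q.points = {p | ∃ m : Fin 2, ∃ z ∈ Lam, p = t m + A z} := by
  sorry

/-- **stub_lineTwoGlue** — registered stub, statement `LineTwoGlue` with its two stub hypotheses
`SelfCertify`, `OptimalPeriodicIsAdmissibleHcp` UNFOLDED (`BulkDefectVanish` is the route decl of
`HcpDefectCounting`, item 0751, BY NAME) (M, bookkeeping). -/
theorem stub_lineTwoGlue :
    HcpDefectCounting.BulkDefectVanish →
    (∀ P : PeriodicConfiguration 3,
      (∀ R ε : ℝ, 0 < R → 0 < ε → ∀ N₀ : ℕ, ∃ N : ℕ, N₀ ≤ N ∧ ∃ x : Fin N → E3,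
        IsGroundState lennardJones x ∧ ∃ (i : Fin N) (A : E3 →ₗᵢ[ℝ] E3),
          (∀ p ∈ P.points, ‖p‖ ≤ R → ∃ j : Fin N, dist (x j) (x i + A p) ≤ ε) ∧
          (∀ j : Fin N, dist (x j) (x i) ≤ R → ∃ p ∈ P.points, dist (x j) (x i + A p) ≤ ε)) →
      IsLeast (Set.range fun Q : PeriodicConfiguration 3 => Q.energyPerParticle lennardJones)
        (P.energyPerParticle lennardJones)) →
    (∀ Q : PeriodicConfiguration 3,
      IsLeast (Set.range fun Q' : PeriodicConfiguration 3 => Q'.energyPerParticle lennardJones)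
        (Q.energyPerParticle lennardJones) →
      ∃ (t : Fin 2 → E3) (A : E3 →L[ℝ] E3), Adm A ∧
        Q.points = {p | ∃ m : Fin 2, ∃ z ∈ Lam, p = t m + A z}) →
    ∀ ρ ε : ℝ, 0 < ρ → 0 < ε → ∃ N₀ : ℕ, ∀ N : ℕ, N₀ ≤ N → ∀ x : Fin N → E3,
      IsGroundState lennardJones x → HasFineBall ρ ε x :=
  Theorems.ExcessDecayLiouvilleFineGrains.stub_lineTwoGlue

/-- **stub_isoDictionaryAt** — registered stub, statement `IsoDictionaryAt` verbatim (S). -/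
theorem stub_isoDictionaryAt :
    ∀ (a h : ℝ) (ha : a ≠ 0) (hh : h ≠ 0),
    |a - 97 / 100| ≤ 1 / 40 → |h / Real.sqrt (2 / 3) - 97 / 100| ≤ 1 / 40 →
    ∀ (ε : ℝ) (N : ℕ) (x : Fin N → E3) (i : Fin N) (R : ℝ),
    (∃ A : E3 →ₗᵢ[ℝ] E3,
      (∀ p ∈ (hcpPeriodicConfiguration ha hh).points, ‖p‖ ≤ R →
        ∃ j : Fin N, dist (x j) (x i + A p) ≤ ε) ∧
      (∀ j : Fin N, dist (x j) (x i) ≤ R →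
        ∃ p ∈ (hcpPeriodicConfiguration ha hh).points, dist (x j) (x i + A p) ≤ ε)) →
    ∃ (t : Fin 2 → E3) (A' : E3 →L[ℝ] E3), Adm A' ∧ Inner t A' ∧
      Near (Set.range x) (x i) R t A' ε :=
  Theorems.ExcessDecayLiouvilleFineGrains.stub_isoDictionaryAt

/-! ## Compositions (sorry-free; each concludes the route decl `ExcessDecayLiouville.FineGrains` BY NAME) -/

/-- **LineOne — the crux BY NAME from `CoarseGrains` (crux stmt-9331, BY NAME) and the registered stubs
`stub_flatComparison`, `stub_tubeRigidity`, `stub_lineOneGlue`** (`fineGrains_iff` is `Iff.rfl`). -/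
theorem FineGrains_of (hCG : ExcessDecayLiouville.CoarseGrains) : ExcessDecayLiouville.FineGrains :=
  fineGrains_iff.2 (stub_lineOneGlue hCG stub_flatComparison tubeRigidity_of_stubs)

/-- **LineTwo — the crux BY NAME from `BulkDefectVanish` (shared hinge stmt-0751, BY NAME) and the
registered stubs `stub_selfCertify`, `stub_optimalPeriodicIsAdmissibleHcp`, `stub_lineTwoGlue`.** -/
theorem FineGrains_of_bulkDefectVanish (h0751 : HcpDefectCounting.BulkDefectVanish) :
    ExcessDecayLiouville.FineGrains :=
  fineGrains_iff.2 (stub_lineTwoGlue h0751 stub_selfCertify stub_optimalPeriodicIsAdmissibleHcp)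

/-- **Sibling reduction — the crux BY NAME from `HcpBulkFloor` (stmt-14477) and `HcpDefectCoercivity`
(stmt-14476), BY NAME, and the registered stub `stub_isoDictionaryAt`.**  Verbatim re-run of the landed
`CoarseGrains_of` at `(ρ, ε)`: floor point `(a,h)` pinned into the window (`windowPin` +
`energyPerParticle_le_of_floor`), `δ` from `LennardJonesMinimalDistance_holds`, `(θ, R')` from
`trussPropagation` at `(δ, ρ, ε)`, `κ(δ,θ)` from coercivity, `N₀` from `stub_trialBound` at
`η = κ/(2(2R'/δ+1)³)`; `κ·#Bad(4,θ) ≤ E(N) − N·e ≤ N·η` gives the clean ball (`exists_clean_ball`), a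
radius-`ρ` chart at tolerance `ε`, and the datum (`stub_isoDictionaryAt`). CONDITIONAL on the two named
sibling cruxes. -/
theorem FineGrains_of_defectCounting (hFloor : HcpDefectCounting.HcpBulkFloor)
    (hCoer : HcpDefectCounting.HcpDefectCoercivity) : ExcessDecayLiouville.FineGrains := by
  classical
  rw [fineGrains_iff]
  intro ρ ε hρ hε
  obtain ⟨a, h, ha, hh, ha₁, ha₂, hh₁, hh₂, hfloor⟩ := hFloor
  obtain ⟨hwa, hwh⟩ := windowPin a h ha hh ha₁ ha₂ hh₁ hh₂ fun a' h' ha' hh' =>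
    energyPerParticle_le_of_floor ha hh hfloor (hcpPeriodicConfiguration ha' hh')
  obtain ⟨δ, hδ, hsep⟩ := LennardJonesMinimalDistance_holds
  obtain ⟨θ, hθ, R', hR', hchart⟩ :=
    trussPropagation a h ha hh ha₁ ha₂ hh₁ hh₂ δ ρ ε hδ hρ hε
  obtain ⟨κ, hκ, hcoer⟩ := hCoer a h ha hh ha₁ ha₂ hh₁ hh₂ hfloor δ θ hδ hθ
  set C : ℝ := (2 * R' / δ + 1) ^ 3 with hC
  have hCpos : 0 < C := by positivity
  obtain ⟨N₁, hN₁⟩ :=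
    stub_trialBound (hcpPeriodicConfiguration ha hh) (κ / (2 * C)) (by positivity)
  refine ⟨max N₁ 1, fun N hN x hx => ?_⟩
  have hN₁' : N₁ ≤ N := le_of_max_le_left hN
  have hNpos : (0 : ℝ) < N := by exact_mod_cast le_of_max_le_right hN
  have hxsep : ∀ i j : Fin N, i ≠ j → δ ≤ dist (x i) (x j) := hsep N x hx
  -- energy bookkeeping: κ·#Bad ≤ 𝓔(x) − N·e = E(N) − N·e ≤ N·κ/(2C)
  have hcoerx := hcoer N x hxsep
  dsimp only at hcoerx
  have hE : interactionEnergy lennardJones x = groundStateEnergy lennardJones 3 N := hx.2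
  have htrial := hN₁ N hN₁'
  rw [hE] at hcoerx
  set e : ℝ := (hcpPeriodicConfiguration ha hh).energyPerParticle lennardJones with he
  set bad : ℝ := (Nat.card {i : Fin N // ¬ ∃ A : EuclideanSpace ℝ (Fin 3) →ₗᵢ[ℝ]
      EuclideanSpace ℝ (Fin 3),
      (∀ p ∈ (hcpPeriodicConfiguration ha hh).points, ‖p‖ ≤ 4 →
        ∃ j : Fin N, dist (x j) (x i + A p) ≤ θ) ∧
      (∀ j : Fin N, dist (x j) (x i) ≤ 4 →
        ∃ p ∈ (hcpPeriodicConfiguration ha hh).points, dist (x j) (x i + A p) ≤ θ)} : ℝ)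
    with hbad
  have hbad0 : 0 ≤ bad := by positivity
  have hk : κ * bad ≤ (N : ℝ) * (κ / (2 * C)) := by linarith
  have hk2 : κ * (bad * (2 * C)) ≤ κ * N := by
    have h2C : (0 : ℝ) < 2 * C := by positivity
    have h1 : κ * bad ≤ (N : ℝ) * κ / (2 * C) := by simpa [mul_div_assoc] using hk
    have h3 := (le_div_iff₀ h2C).1 h1
    nlinarith [h3]
  have hk3 : bad * (2 * C) ≤ N := le_of_mul_le_mul_left hk2 hκ
  have hcount : C * bad < N := by nlinarith [hk3, hCpos, hNpos, hbad0]
  -- clean ball by counting Bad(4,θ) particles over balls centred at particles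
  obtain ⟨i, hi⟩ := exists_clean_ball x hδ hR' hxsep _ hcount
  -- truss propagation: the clean ball carries a radius-ρ chart at tolerance ε
  have hcharti := hchart N x hxsep
  dsimp only at hcharti
  have hgood := hcharti i fun j hj => not_not.1 (hi j hj)
  -- dictionary: the chart is a FineGrains datum centred at `x i`
  obtain ⟨t, A', hA', -, hNear⟩ := stub_isoDictionaryAt a h ha hh hwa hwh ε N x i ρ hgood
  exact ⟨x i, t, A', hA', hNear⟩

end Summit.AtomisticToContinuum.Crystallization.Cruxes.FineGrains.Sketch

end
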